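import Literature.AnabelianGeometry.EtaleTheta.Discharge.Sec5OfBiKummerDataKummer
import Literature.AnabelianGeometry.EtaleTheta.Discharge.Sec4Model
import Literature.AnabelianGeometry.EtaleTheta.FrobenioidKummerOut

/-!
# [EtTh] §5 data assembled over the MODEL bi-Kummer setting: the dictionary laws discharged (pp. 322–331 / PDF pp. 96–105)

Mochizuki, *The étale theta function …*, Publ. RIMS **45** (2009)
[cite: MochizukiEtTh2009, §5 p.322–331 (PDF pp.96–105)].  Seat abc-iut-L2-t4 (§5 owner), merge row W3-L2-01 «§5 GENUINE
DATA», PROOF-ONLY sequel of `FrobenioidThetaOfBiKummerData.lean` / `Discharge/Sec5OfBiKummerDataKummer.lean`.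

For abc-iut-L2-t9's MODEL instance `BiKummerSetting.mkOfModel X tf …` of the §4 setting (birational units `O^×(A^birat) :=
B(A_D)^×`, [FrdI] Thm. 5.2 (ii)) the [FrdI] Thm. 5.2 (ii) dictionary `toB` of `ThetaFrobenioid.ofBiKummerData` is the
IDENTITY and its laws are theorems (abc-iut-L6-t12's `Discharge/Sec4Model.lean`: `coe_fracOfModel_mul_unit`,
`coe_biratAutModel_eq_pull`; pull-back of birational units = `TemperedFrobenioid.pullFracModel`, identity along identities).
Hence, for the §5 data assembled over the model: the bundle `Facts` of §5 named inputs follows from the section property of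
`σ` ([FrdI] Prop. 5.6), `Π^tp_Ÿ ⊆ H_⊙` (p.322 (PDF p.96)) and `ConstantsActByCyclotome` (Lemma 5.8) — `facts_ofModelData` —
the "natural action" of `Aut_C(B_N)` on `O^×(B_N^birat)` that abc-iut-L2-t11's `K^×`-part of `D` needs (hypothesis structure
`ThetaFrobenioid.BiratAutAction`, `FrobenioidKummerOut.lean`: "TODO-merge(abc-iut-L2-t3/abc-iut-L2-t9): instantiate from
`biratAut` / `biratAutModel`") is INSTANTIATED by abc-iut-L2-t9's `biratAutModel` (`biratAutAction_ofModelData`: equivariance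
of `O^×(B_N) ↪ O^×(B_N^birat)` PROVED by the [FrdI] Thm. 5.2 unit calculus, triviality on `O^×(B_N)` = t9's
`biratAutModel_eq_one_of_mem_units`; the constants-fixed law is the input `hconst`, Def. 3.6 (iii)),
and Prop. 5.2 (i) holds modulo the Rmk. 4.3.2 composite-root reading only (`thetaPairIsRoot_ofModelData`, GAP row G-L2t4-1; the pull-back `pullFrac` of abc-iut-L2-t3's `NthRoot` stays a parameter with `pullFrac (𝟙 _) = id` — e.g. `TemperedFrobenioid.pullFracModel`, `pullFracModel_id`).
HONEST FRAMING: kernel-checked consequences for data so constructed; nothing of [EtTh] is asserted unconditionally; no side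
is taken on anything downstream.
-/

noncomputable section

namespace Literature.AnabelianGeometry.EtaleTheta

open CategoryTheory Opposite Literature.AlgebraicGeometry.Frobenioids

universe u₀ v₀ u v w

namespace TemperedFrobenioid

variable {D₀ : Type u₀} [Category.{v₀} D₀] {V : FrdIMonoidStub.{w}} {T₀ : RealifiedDivisorMonoids (D₀ := D₀) V}
  {D : Type u} [Category.{v} D] {VD : FrdICatStub.{u, v, w} D} (tf : TemperedFrobenioid T₀ D VD)

/-- Pull-back of birational units along an identity is the identity (`B(id) = id`).
[cite: MochizukiEtTh2009, Prop 4.2 p.314 (PDF p.88)] -/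
theorem pullFracModel_id (A : tf.category) (x : tf.biratUnitsModel A) : tf.pullFracModel (𝟙 A) x = x := by
  apply Units.ext
  rw [coe_pullFracModel_apply]
  change (tf.ratFnFunctor.map (𝟙 (op A.base))).hom (x : tf.ratFnFunctor.obj (op A.base)) = x
  rw [tf.ratFnFunctor.map_id]
  rfl

end TemperedFrobenioid

namespace ThetaFrobenioid

variable {K : Type u₀} [Field K] {X : SemiGraphs.TemperedArithmeticGroup.{u₀} K} {D₀ : Type u₀} [Category.{v₀} D₀]
  {V : FrdIMonoidStub.{w}} {T₀ : RealifiedDivisorMonoids (D₀ := D₀) V} {D : Type u} [Category.{v} D]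
  {VD : FrdICatStub.{u, v, w} D} {tf : TemperedFrobenioid T₀ D VD} {hZ : tf.monoidType = MonoidType.Z}
  {hP : ∀ A : Dᵒᵖ, IsPerfect (tf.Φ.carrier A)} {hBΛ : ∀ (Y : D₀ᵒᵖ) (b : T₀.BΛ.obj Y), IsUnit b}
  {DS : ∀ {A : Dᵒᵖ}, tf.Φ.carrier A → tf.Φ.carrier A → Prop} {IG : D → Prop}
  {gS : ∀ A : D, IG A → (X.Pi →* Aut A)} {gSs : ∀ (A : D) (h : IG A), Function.Surjective (gS A h)}
  {NH : Subgroup (Field.absoluteGaloisGroup K) → tf.category → ℕ+ → Prop}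
  {AB : ∀ {A B : tf.category}, Subgroup (Aut A) → (A ⟶ A) → (A ⟶ B) → Prop} {A₀ : tf.category}
  {hA₀ : PreFrobenioid.IsFrobeniusTrivial tf.toElem A₀} {hA₀' : IG A₀.base}
  {pullFrac : ∀ {A A' : (BiKummerSetting.mkOfModel X tf hZ hP hBΛ DS IG gS gSs NH AB A₀ hA₀ hA₀').C} (_ : A' ⟶ A),
    (BiKummerSetting.mkOfModel X tf hZ hP hBΛ DS IG gS gSs NH AB A₀ hA₀ hA₀').biratUnits A →
      (BiKummerSetting.mkOfModel X tf hZ hP hBΛ DS IG gS gSs NH AB A₀ hA₀ hA₀').biratUnits A'}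
  {lv N : ℕ+} {T : ThetaEnvData.{max v w} N}
  {θ : (BiKummerSetting.mkOfModel X tf hZ hP hBΛ DS IG gS gSs NH AB A₀ hA₀ hA₀').biratUnits
    (BiKummerSetting.mkOfModel X tf hZ hP hBΛ DS IG gS gSs NH AB A₀ hA₀ hA₀').Aodot}
  {Bl : (BiKummerSetting.mkOfModel X tf hZ hP hBΛ DS IG gS gSs NH AB A₀ hA₀ hA₀').C}
  {Pl : (BiKummerSetting.mkOfModel X tf hZ hP hBΛ DS IG gS gSs NH AB A₀ hA₀ hA₀').FractionPair θ Bl}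
  {Rl : (BiKummerSetting.mkOfModel X tf hZ hP hBΛ DS IG gS gSs NH AB A₀ hA₀ hA₀').NthRoot θ Pl lv pullFrac}
  (h : ModelFrobenioid.Hypotheses tf.divisorMonoid tf.ratFnFunctor) (Q : FrobenioidTheta.ThetaSubquotientStub.{w} D)
  (odd_l : Odd (lv : ℕ))
  (R : (BiKummerSetting.mkOfModel X tf hZ hP hBΛ DS IG gS gSs NH AB A₀ hA₀ hA₀').NthRoot Rl.root Rl.pair N pullFrac)
  (ιX : T.PiX ≃ₜ* X.Pi)
  (hopen : IsOpen (((BiKummerSetting.mkOfModel X tf hZ hP hBΛ DS IG gS gSs NH AB A₀ hA₀ hA₀').galoisSurj R.AN.base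
    R.αData.isGalois).ker : Set X.Pi))
  (σ : Aut R.AN.base →* Aut R.AN) (K' : Type w) [Field K']
  (constEmb : K'ˣ →* (BiKummerSetting.mkOfModel X tf hZ hP hBΛ DS IG gS gSs NH AB A₀ hA₀ hA₀').tf.biratUnitsModel R.BN)
  (constEmb_injective : Function.Injective constEmb)
  (hdivc : ∀ g : Aut R.BN.base,
    ModelFrobenioid.div ((σ ((BiKummerSetting.NthRoot.baseIso
      (BiKummerSetting.mkOfModel X tf hZ hP hBΛ DS IG gS gSs NH AB A₀ hA₀ hA₀') R).conjAut.symm g)).hom ≫ R.pair.num) =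
      ModelFrobenioid.div R.pair.num)
  (hdivp : ∀ y : T.PiYdd,
    ModelFrobenioid.div ((σ ((BiKummerSetting.mkOfModel X tf hZ hP hBΛ DS IG gS gSs NH AB A₀ hA₀ hA₀').galoisSurj R.AN.base
      R.αData.isGalois (ιX y.1))).hom ≫ R.pair.den) = ModelFrobenioid.div R.pair.den)

/-- **The bundle `Facts` of §5 named inputs for the §5 data assembled over the MODEL setting** (dictionary = identity): from
the section property of `σ` ([FrdI] Prop. 5.6), `Π^tp_Ÿ ⊆ H_⊙ = Ker(Π^tp_X ↠ Aut_D(A_⊙^bs))` (p.322 (PDF p.96)) and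
`ConstantsActByCyclotome` (Lemma 5.8) — Prop. 4.3 (iii), the defining relations, Aut-ampleness and total epimorphicity being
THEOREMS.  [cite: MochizukiEtTh2009, §5 p.330–331 (PDF pp.104–105)] -/
theorem facts_ofModelData (hσ : ∀ g : Aut R.AN.base, ModelFrobenioid.baseMap (σ g).hom = g.hom)
    (hH : ∀ y : T.PiX, y ∈ T.PiYdd →
      ιX y ∈ (BiKummerSetting.mkOfModel X tf hZ hP hBΛ DS IG gS gSs NH AB A₀ hA₀ hA₀').Hodot)
    (hK : (ofBiKummerData h (fun _ => MonoidHom.id _) Q odd_l R ιX hopen σ K' constEmb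
      constEmb_injective hdivc hdivp).ConstantsActByCyclotome) :
    (ofBiKummerData h (fun _ => MonoidHom.id _) Q odd_l R ιX hopen σ K' constEmb
      constEmb_injective hdivc hdivp).Facts :=
  facts_ofBiKummerData' h _ Q odd_l R ιX hopen σ K' constEmb constEmb_injective hdivc hdivp hσ hH
    (fun s' s'' _ _ _ => BiKummerSetting.coe_fracOfModel_mul_unit tf hBΛ s' s'')
    (fun e x => BiKummerSetting.coe_biratAutModel_eq_pull tf e x) hK

/-- **[EtTh] Prop. 5.2 (i) for the §5 data assembled over the MODEL setting**, at the real vocabulary (the identification of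
birational units being the identity): holds modulo the Rmk. 4.3.2 composite-root binder `hcomp` alone (GAP row G-L2t4-1).
[cite: MochizukiEtTh2009, Prop 5.2 (i) p.324 (PDF p.98)] -/
theorem thetaPairIsRoot_ofModelData
    (hpull_id : ∀ (A : (BiKummerSetting.mkOfModel X tf hZ hP hBΛ DS IG gS gSs NH AB A₀ hA₀ hA₀').C)
      (x : (BiKummerSetting.mkOfModel X tf hZ hP hBΛ DS IG gS gSs NH AB A₀ hA₀ hA₀').biratUnits A), pullFrac (𝟙 A) x = x)
    (hcomp : (BiKummerSetting.mkOfModel X tf hZ hP hBΛ DS IG gS gSs NH AB A₀ hA₀ hA₀').PairIsNthRootOf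
      pullFrac ((lv : ℕ) * N) θ R.pair.num R.pair.den) :
    FrobenioidThetaBiKummer.ThetaPairIsRoot
      (ofBiKummerData h (fun _ => MonoidHom.id _) Q odd_l R ιX hopen σ K' constEmb
        constEmb_injective hdivc hdivp)
      (FrobenioidThetaBiKummer.BiKummerVocabStub.ofBiKummerSetting
        (BiKummerSetting.mkOfModel X tf hZ hP hBΛ DS IG gS gSs NH AB A₀ hA₀ hA₀') pullFrac _
        fun _ => (MulEquiv.ofBijective (MonoidHom.id _) Function.bijective_id).symm) :=
  thetaPairIsRoot_ofBiKummerData h _ Q odd_l R ιX hopen σ K' constEmb constEmb_injective hdivc hdivp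
    (fun _ => Function.bijective_id) hpull_id hcomp

/-- In the model Frobenioid, conjugating a unit `u ∈ O^×(X)` by an automorphism `e` pulls its rational function back along
`Base(e⁻¹)`: `u_{e ∘ u ∘ e⁻¹} = B(Base(e⁻¹))(u_u)` ([FrdI] Thm. 5.2 (i) composition law for `u_φ`; `Base(u) = id`).
[cite: MochizukiFrdI2008, Thm. 5.2 (i) p.100] -/
theorem unit_conj_of_mem_units {Φ B : Dᵒᵖ ⥤ CommMonCat.{w}} {DivB : B ⟶ monoidGp Φ} {Y : ModelFrobenioid Φ B DivB}
    (e : Aut Y) (u : Aut Y) (hu : u ∈ ModelFrobenioid.units Y) :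
    ModelFrobenioid.unit (e * u * e⁻¹).hom = pull B (ModelFrobenioid.baseMap e.inv) (ModelFrobenioid.unit u.hom) := by
  have e0 : pull B (ModelFrobenioid.baseMap e.inv) (ModelFrobenioid.unit e.hom) * ModelFrobenioid.unit e.inv = 1 := by
    have h0 := congrArg ModelFrobenioid.unit e.inv_hom_id
    rwa [ModelFrobenioid.unit_comp_of_degFr_eq_one _ (ModelFrobenioid.degFr_eq_one_of_isIso _),
      ModelFrobenioid.unit_id] at h0
  change ModelFrobenioid.unit (e.inv ≫ u.hom ≫ e.hom) = _
  rw [ModelFrobenioid.unit_comp_of_degFr_eq_one _ (ModelFrobenioid.degFr_eq_one_of_isIso _),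
    ModelFrobenioid.unit_comp_of_degFr_eq_one _ (ModelFrobenioid.degFr_eq_one_of_isIso _), hu.1,
    Literature.AlgebraicGeometry.Frobenioids.pull_id, map_mul, mul_right_comm, e0, one_mul]

/-- **The "natural action" of `Aut_C(B_N)` on `O^×(B_N^birat)` for the §5 data assembled over the MODEL setting** — the
hypothesis structure `BiratAutAction` of abc-iut-L2-t11's `K^×`-part of `D` (Lemma 5.8 / 5.9 (iv), `FrobenioidKummerOut.lean`)
INSTANTIATED by abc-iut-L2-t9's `biratAutModel` (the `Aut_C(A)`-action on `B(A_D)^×` through `Aut_D(A_D)`, [FrdI] Thm. 5.2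
(ii); Def. 4.1 (iii) "the natural action"): the equivariance of `O^×(B_N) ↪ O^×(B_N^birat)` is the [FrdI] Thm. 5.2 (i) unit
calculus (`unit_conj_of_mem_units`), `O^×(B_N)` acts trivially (`biratAutModel_eq_one_of_mem_units`), and the constants are
fixed by the input `hconst` (Def. 3.6 (iii): `K^× ↪ O^×(B_N^birat)` lands in the `Aut`-invariants).
[cite: MochizukiEtTh2009, Lem 5.8 p.331 (PDF p.105); Def 4.1 (iii) p.313 (PDF p.87)] -/
def biratAutAction_ofModelData (hconst : ∀ (e : Aut R.BN) (k : K'ˣ), tf.biratAutModel R.BN e (constEmb k) = constEmb k) :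
    (ofBiKummerData h (fun _ => MonoidHom.id _) Q odd_l R ιX hopen σ K' constEmb constEmb_injective hdivc
      hdivp).BiratAutAction where
  act := tf.biratAutModel R.BN
  act_unitsToBirat e u := by
    apply Units.ext
    change pull tf.ratFnFunctor (ModelFrobenioid.baseMap e.inv) (ModelFrobenioid.unit u.1.hom) =
      ModelFrobenioid.unit (e * u.1 * e⁻¹).hom
    exact (unit_conj_of_mem_units e u.1 u.2).symm
  act_units u := tf.biratAutModel_eq_one_of_mem_units u.2
  act_constEmb e k := hconst e k

/-- The action of the instantiated `BiratAutAction` is `biratAutModel`: `e · f = B(Base(e⁻¹))(f)` on `B(B_N^bs)^×`.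
[cite: MochizukiEtTh2009, Def 4.1 (iii) p.313 (PDF p.87)] -/
theorem biratAutAction_ofModelData_act
    (hconst : ∀ (e : Aut R.BN) (k : K'ˣ), tf.biratAutModel R.BN e (constEmb k) = constEmb k) (e : Aut R.BN) :
    (biratAutAction_ofModelData h Q odd_l R ιX hopen σ K' constEmb constEmb_injective hdivc hdivp hconst).act e =
      tf.biratAutModel R.BN e := rfl

end ThetaFrobenioid

end Literature.AnabelianGeometry.EtaleTheta

end
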